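import Literature.NumberTheory.LFunctions.GeneralizedRH
import Literature.NumberTheory.LFunctions.OneLevelDensityPrimeLevelForms
import Literature.NumberTheory.LFunctions.CentralValueFamilyWindowedSupply
import Literature.NumberTheory.LFunctions.IwaniecSarnakFamilyWeightTwo
import Literature.NumberTheory.LFunctions.Zhang2022.SkeletonSetting

/-!
# Route `PrimeLevelFamEdge` — TYPED IDEA DELTAS, deck 4: the DENSITY DOOR (card K-L7-2 ★, lens-7;
cell ls-idea) — «zero crystallisation ⇒ ownership: in the (A)-world the door U-d at a compatible
prime level is a ONE-LEVEL-DENSITY statement for H₂⁺(q) with Fourier support v > v* ≈ 1 + 1/√2»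

PROOF-FREE `def … : Prop` delta + one-line KERNEL glue through the landed consumer
`CentralValueFamily.lOne_lowerBound_of_compatibleSupplyGoodA` (p553195, lens-4) over the
one-level-density vocabulary `OneLevelDensityCusp.*` (Literature/…/OneLevelDensityPrimeLevelForms.lean).
Serves the route target `FamEdgeWeightTwo` (stmt-Parity-20004) in its (A)-localised one-level form.
NOTHING IS ASSERTED; «typed ≠ proved; no exceptional-zero theorem (no Landau–Siegel exclusion, no
Theorem 1–2 of arXiv:2211.02515, no repaired Margin232) is proved by ideation». Card / verdicts:
`run/shared/lean/pub/ls-idea/cards/ls-idea-lens-7.md` (K-L7-2 + addendum v1.1), critics A PASS ·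
B PASS ★ (priced: F2 bilinear Kloosterman with power saving beyond Weil, W-PV) · C PASS-with-FIX («add
ILS GRH support 2 ⇒ 9/16 as the comparison»).
-/

noncomputable section

namespace Summit.Parity.GeneralizedHardyLittlewood.Theorems.PrimeLevelFamEdgeIdeaDeltas

open Literature.NumberTheory.LFunctions
open Literature.NumberTheory.LFunctions.CentralValueFamilyHalfEdge

/-- **K-L7-2 ★ «ZERO CRYSTALLISATION ⇒ OWNERSHIP» — the DENSITY DOOR.** Mechanism (card): at a
compatible prime level `q ∈ [D^{c₁}, D^{c₂}]` under (A)_D, the completed product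
`Λ_f(s)Λ_{f⊗χ_D}(s)` has Dirichlet coefficients supported on norms from `K = ℚ(√D*)`; (A) makes its
low zeros CRYSTALLISE onto a lattice of period `≍ 1/log q` near `½`, each central pair being OWNED by
`L(s,f)` or by `L(s,f⊗χ_D)`; with (7.3)–(7.6) forcing `ω(S_f) = ω(S_χ) = ½ + o(1)` unless the door
opens, the (A)-localised edge `X^{(A)} ⟺ ω(S_f) ≤ ½ − η` at one compatible level becomes the
ONE-LEVEL-DENSITY estimate `ω(S_f) ≤ [φ̂(0) + ½∫_{−1}^{1}φ̂(u)du]/(2φ(0))` for `H₂⁺(q)` — strictly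
below `½` iff the Fourier support `v` of `φ̂` exceeds `v* ≈ 1 + 1/√2` (Fejér-type optimisation;
ILS give support 2 ⇒ 9/16 under GRH as the comparison, critic C's FIX). TYPED FORM: «the SO(even)
one-level density for `H₂⁺(q)` with support `v` DELIVERS the (A)-localised one-level (7.5)-edge» —
`EvenDensitySOEven 2 v → primeLevelFamilyTwo.CompatibleSupplyGoodA p₁ a δ K A` (lens-4's windowed
supply shape, landed p553195), the card's content being that this implication holds for `v > v*`
with some `p₁ > ½` (the density→non-vanishing conversion with ownership). Controls: TARGET #0
`FamEdgeWeightTwo` in (A)-localised one-compatible-level form (K-L7-0 frame); the new NEEDED number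
is the support `v > v*` (C4″ density currency; desk's row question to ls-rescue-lead 18:01Z).
Falsifiers (card): F1 ownership bookkeeping; F2 the price — a bilinear Kloosterman estimate with
POWER saving beyond Weil at support `v > 3/2` (ref-2 W-PV 18:10:12Z: out of range of every typed
bilinear-Kloosterman theorem); F3 `v*` ±0.02 under finer QP. PARAMETERS `v, A, δ, K, p₁, a`;
nothing asserted; typed ≠ proved. [cite: IwaniecLuoSarnak2000, Thm. 1.1 and remark (B) p. 4]
[cite: IwaniecConversations2006, §7 (7.5)–(7.7), p. 97 L13–L15] -/
def DensityDoor (v : ℝ) (A : ℕ) (δ K p₁ : ℝ) (a : ℕ) : Prop :=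
  OneLevelDensityCusp.EvenDensitySOEven 2 v → primeLevelFamilyTwo.CompatibleSupplyGoodA p₁ a δ K A

/-- **Glue (kernel, one line): the density door + a one-level density theorem with support `v`
close the rung in the (A)-localised form.** Given `DensityDoor v A δ K p₁ a` with `p₁ + p₂ > 1`,
`EvenDensitySOEven 2 v`, and the pointwise printed shapes of Conversations §7 for the prime-level
weight-2 family (non-negativity, even mass, mixed moment, twisted half at `p₂`), one gets
`L(1,χ_D) ≥ c (log D)^{−max(A, 2a)}` for all large `D` — lens-4's windowed consumer
`lOne_lowerBound_of_compatibleSupplyGoodA` fed by the door. [cite: IwaniecConversations2006, §7 (7.7)] -/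
theorem lOne_lowerBound_of_densityDoor {v δ K p₁ p₂ : ℝ} {A a : ℕ} (hK : 0 < K)
    (hD : DensityDoor v A δ K p₁ a) (hdens : OneLevelDensityCusp.EvenDensitySOEven 2 v)
    (hnn : primeLevelFamilyTwo.Nonneg) (hmass : primeLevelFamilyTwo.EvenMassLower)
    (hmix : primeLevelFamilyTwo.MixedMomentUpper δ) (htw : primeLevelFamilyTwo.TwistedHalf p₂ a δ)
    (hp : 1 < p₁ + p₂) :
    ∃ c : ℝ, 0 < c ∧ ∃ D₀ : ℕ, ∀ (D : ℕ) [NeZero D] (χ : DirichletCharacter ℂ D), D₀ ≤ D →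
      χ.IsPrimitive → MulChar.IsQuadratic χ →
        c * ((Real.log D) ^ (max A (2 * a)))⁻¹ ≤ (χ.LFunction 1).re :=
  primeLevelFamilyTwo.lOne_lowerBound_of_compatibleSupplyGoodA hK hnn hmass hmix htw (hD hdens) hp

/-- Bookkeeping (proved): the density door is antitone in the support — a door at support `v`
is a door at every larger support `v' ≥ v` (a density theorem with larger support implies the one
with smaller support). [cite: IwaniecLuoSarnak2000, Thm. 1.1] -/
theorem DensityDoor.mono {v v' : ℝ} {A : ℕ} {δ K p₁ : ℝ} {a : ℕ} (hv : v ≤ v')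
    (h : DensityDoor v A δ K p₁ a) : DensityDoor v' A δ K p₁ a :=
  fun hd ↦ h (hd.anti hv)

/-! ## §2 V4-1 «ZERO-FREE-BOX LEDGER FOR THE ε_f PIECE OF G-25» — the density door's PRICE CELL as a
typed hypothesis shape (lens-7 gen 4 §v4; critic A PASS as INPUT LEDGER + NO-GO TEST, batch 25:
«G-25's price cell NAMED — ZFB(1/v*; N^{v*−1}; (log N)²) = quasi-GRH(σ > 0.591) for Dirichlet L of
conductor ≤ N^{0.691} coprime to N»; B/C pending). A PARAMETRIC hypothesis; nothing asserted. -/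

/-- **Zero-free BOX for Dirichlet `L`-functions of bounded modulus coprime to a level** (V4-1's
currency): every Dirichlet character `χ` to a modulus `m ≤ Q` with `(m, N) = 1` has
`L(s, χ) ≠ 0` in the box `σ₀ < Re s < 1`, `|Im s| ≤ T`. (Mathlib's `DirichletCharacter.LFunction` of a
non-primitive character differs from the primitive one by finitely many Euler factors with no zeros in
`Re s > 0`, so quantifying over all characters to modulus `≤ Q` is the same box as over primitive
conductors `≤ Q`.) For `Q = 1` this is a zero-free box for `ζ` (cf. the tree's
`QuasiRiemannHypothesis σ₀`, the `T = ∞` strip). A PREDICATE in `(N, σ₀, Q, T)`; `σ₀ ≥ 1` or `T < 0`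
make it vacuous-true; never asserted. [cite: IwaniecLuoSarnak2000, §3 (132) and p. 22 (129) (where ILS use RH for the inserted pieces)] -/
def DirichletZeroFreeBox (N : ℕ) (σ₀ Q T : ℝ) : Prop :=
  ∀ (m : ℕ) [NeZero m], (m : ℝ) ≤ Q → m.Coprime N → ∀ χ : DirichletCharacter ℂ m, ∀ s : ℂ,
    σ₀ < s.re → s.re < 1 → |s.im| ≤ T → χ.LFunction s ≠ 0

/-- **V4-1's PRICE CELL for the ε_f piece of the G-25 density door**: at prime level `N` and Fourier
support `v ∈ (1, 2)`, the inserted root-number piece (ILS §3.2 term IV) is controlled by the box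
`ZFB(1/v; N^{v−1}; (log N)²)` — quasi-GRH with abscissa `1/v` for all Dirichlet `L` of modulus
`≤ N^{v−1}` coprime to `N`, height `(log N)²` (the card's ledger (L1)–(L4); at `v* = 1.691`:
`σ > 0.591`, conductor `≤ N^{0.691}`). The DEURING–HEILBRONN WIDTH TEST of the card (does (A)_D pay this
through repulsion?) is its NO-GO reading: the repulsion width `w → 1/(2C(1+K(v−1)))` falls short of
`1 − 1/v*` unless `C ≤ 0.187`. A PREDICATE in `(N, v)`; nothing asserted; typed ≠ proved.
[cite: IwaniecLuoSarnak2000, §3 (132)] -/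
def DensityDoorPriceBox (N : ℕ) (v : ℝ) : Prop :=
  DirichletZeroFreeBox N (1 / v) ((N : ℝ) ^ (v - 1)) (Real.log N ^ 2)

/-- Bookkeeping (proved): the box is monotone — a larger abscissa `σ₀' ≥ σ₀`, a smaller modulus range
`Q' ≤ Q` and a lower height `T' ≤ T` are implied. [cite: IwaniecLuoSarnak2000, §3 (132)] -/
theorem DirichletZeroFreeBox.mono {N : ℕ} {σ₀ σ₀' Q Q' T T' : ℝ} (h : DirichletZeroFreeBox N σ₀ Q T)
    (hσ : σ₀ ≤ σ₀') (hQ : Q' ≤ Q) (hT : T' ≤ T) : DirichletZeroFreeBox N σ₀' Q' T' :=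
  fun m _ hm hcop χ s h1 h2 h3 ↦ h m (hm.trans hQ) hcop χ s (lt_of_le_of_lt hσ h1) h2 (h3.trans hT)

/-- Bookkeeping (proved): at modulus `1` the box contains the ζ-box — the tree's strip hypothesis
`QuasiRiemannHypothesis σ₀` (all heights) implies the `Q < 2` box at every height `T`, since the only
modulus `m ≤ Q < 2` with `NeZero m` is `m = 1` and `L(s, 1 mod 1) = ζ(s)`
(`DirichletCharacter.LFunction_modOne_eq`). [cite: MontgomeryVaughan2007, §10.1 (after Cor. 10.3)] -/
theorem dirichletZeroFreeBox_of_quasiRH {N : ℕ} {σ₀ Q T : ℝ} (hQ : Q < 2)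
    (h : QuasiRiemannHypothesis σ₀) : DirichletZeroFreeBox N σ₀ Q T := by
  intro m _ hm _ χ s h1 h2 _ hzero
  have hm1 : m = 1 := by
    have hm0 : m ≠ 0 := NeZero.ne m
    have : (m : ℝ) < 2 := lt_of_le_of_lt hm hQ
    have : m < 2 := by exact_mod_cast this
    omega
  subst hm1
  have hχ : χ = 1 := Subsingleton.elim _ _
  subst hχ
  rw [DirichletCharacter.LFunction_modOne_eq] at hzero
  exact h s hzero h1 h2

/-! ## §3 K-I3-10 «PAGE-PRICED LINNIK LEDGER ⇒ T(ε) + WINDOW-MASS TIGHTNESS OF G-25» (lens-3 gen 5;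
critics A PASS b49 · B PASS b54 · C PASS b51, ≤ new-combination, not ★) — the G-25 density door in
WINDOW-MASS currency, typed from lens-3's `Sketch_K310_WindowMass.lean` (sha16 4a6aeb914a2f8de8,
rc 0) VERBATIM up to (i) the namespace and (ii) the SO(even) functional: the sketch's local
`soEvenLimitFix g = g 0 + ½∫_{[−1,1]} g` is the tree's `OneLevelDensityCusp.soEvenLimit` AFTER the
one-token ERRATUM E-I3-1 (`∫ g` ↦ `g 0`, proposal p590857), so the tree functional is used directly.
Objects: window profiles `g ≥ 0` supported in `1 + 2d₀ ≤ |u| ≤ 1 + 2d₁` (for which the SO(even)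
prediction is `0`), the one-sided window mass `m(g) = ∫_{u>0} g`, the signed window-mass DOOR_W
(`‖D⁺(g;q)‖ ≤ θ'·m(g)` eventually along the primes, every `θ' > θ`), the BRIDGE shape
`WindowMassDoorBridge k A` «∃ window, ∃ θ < 1, DOOR_W ⇒ `Zhang2022.Skeleton.LOneLowerBound A`» (card:
`k = 2`, `A = 1`; parametric so that the gate does not read a 0-ary `Prop` as a citable fact) (the card's (A)-world TIE θ* = 1:
pencil, NOT asserted), and the unconditional TARGET shape T₀(ε) (signed-density tail bound beyond
support 1). PARAMETRIC `Prop`s + definitional bookkeeping; NOTHING about `L`-functions is asserted or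
proved; typed ≠ proved. Card: `run/shared/lean/pub/ls-idea/cards/ls-idea-lens-3.md` §Fifth wave
(sha16 8c4e7d25f18c1550 l.146–155). -/

/-- **Window profiles** (K-I3-10): `g : ℝ → ℝ` smooth, even, non-negative, supported in the two-sided
window `1 + 2d₀ ≤ |u| ≤ 1 + 2d₁` — so `g 0 = 0` and `∫_{[−1,1]} g = 0` when `d₀ > 0`, i.e. the SO(even)
prediction `soEvenLimit g` vanishes and the whole even harmonic density of `g` is «beyond support 1».
A PREDICATE; nothing asserted. [cite: IwaniecLuoSarnak2000, Thm. 1.1 and remark (B) p. 4 (support beyond (−1,1))] -/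
def IsWindowProfile (d₀ d₁ : ℝ) (g : ℝ → ℝ) : Prop :=
  ContDiff ℝ (⊤ : ℕ∞) g ∧ (∀ u, g (-u) = g u) ∧ (∀ u, 0 ≤ g u) ∧
    tsupport g ⊆ {u : ℝ | 1 + 2 * d₀ ≤ |u| ∧ |u| ≤ 1 + 2 * d₁}

/-- **The one-sided window mass** `m(g) = ∫_{u > 0} g(u) du` (K-I3-10's currency: in the (A)-world
the card's pencil law gives `‖D⁺(g; N_j)‖ → m(g)` along compatible and incompatible prime levels).
[cite: IwaniecLuoSarnak2000, §1 (1.3) (the harmonic density D(f;φ))] -/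
def windowMass (g : ℝ → ℝ) : ℝ :=
  ∫ u in Set.Ioi (0 : ℝ), g u

/-- **DOOR_W — the signed window-mass door** at weight `k`, window `(d₀, d₁)`, contraction `θ`
(K-I3-10 (2)): for every window profile `g` and every `θ' > θ`, eventually along the primes `q`,
`‖D⁺(g; q)‖ ≤ θ' · m(g)`, where `D⁺ = OneLevelDensityCusp.evenDensity q k g` is the harmonic one-level
density of the even forms `H_k^+(q)`. Junk-free (`∀ᶠ` over the prime subtype, no `limsup`). The card's
content: NEZ(η) ∧ T(ε) ⇒ DOOR_W with some `θ(η, ε) < 1`; conversely a door with `θ < 1` excludes the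
exceptional zero (`WindowMassDoorBridge 2 1`). A PREDICATE in `(k, d₀, d₁, θ)`; nothing asserted;
typed ≠ proved. [cite: IwaniecLuoSarnak2000, Thm. 1.1 (the statistic; support beyond 1 is the door)] -/
def SignedWindowMassDoor (k : ℤ) (d₀ d₁ θ : ℝ) : Prop :=
  ∀ g : ℝ → ℝ, IsWindowProfile d₀ d₁ g → ∀ θ' : ℝ, θ < θ' →
    ∀ᶠ q : {q : ℕ // q.Prime} in Filter.atTop,
      haveI : NeZero (q : ℕ) := ⟨q.2.ne_zero⟩
      ‖OneLevelDensityCusp.evenDensity (q : ℕ) k (fun u ↦ (g u : ℂ))‖ ≤ θ' * windowMass g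

/-- **The G-25 door in window-mass currency — BRIDGE shape** (K-I3-9 (4)+(5) / K-I3-10 (2)) at
weight `k` and exponent `A` (the card's instance is `k = 2`, `A = 1`): a signed window-mass door with
SOME contraction `θ < 1` on SOME non-degenerate window `0 < d₀ < d₁` at weight `k` gives
`L(1,χ_D) ≫ (log D)^{−A}` (`Zhang2022.Skeleton.LOneLowerBound A`). Pencil route (card, NOT carried out
here): `¬LOneLowerBound 1` ⇒ Siegel zeros with `δ_j log D_j → 0` (Hecke–Landau–Page) ⇒ prime levels
`N_j ∈ [D_j^{1/d₀}, 2D_j^{1/d₀}]` with `‖D⁺(g; N_j)‖ → m(g)` by the (A)-world law — the TIE `θ* = 1`;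
so the G-25 door in this currency IS the exceptional zero up to T(ε) + Hecke–Landau slack (honest
grade: two-sided REFORMULATION + frontier target, not a new door). Rider R-T: this shape does not
route through `soEvenLimit`. A PARAMETRIC `Prop` (an implication) in `(k, A)`, NOT asserted — a
card shape, not a published fact; typed ≠ proved.
[cite: IwaniecLuoSarnak2000, remark (B) p. 4] [cite: Zhang2022LandauSiegel, §1 Theorem 1 (the shape LOneLowerBound)] -/
def WindowMassDoorBridge (k : ℤ) (A : ℕ) : Prop :=
  (∃ d₀ d₁ θ : ℝ, 0 < d₀ ∧ d₀ < d₁ ∧ θ < 1 ∧ SignedWindowMassDoor k d₀ d₁ θ) →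
    Zhang2022.Skeleton.LOneLowerBound A

/-- **T₀(ε) — unconditional signed-density TAIL BOUND beyond support 1** (K-I3-10 (1), the
structureless corollary of the Page-priced Linnik ledger T(ε); FRONTIER TARGET, nothing asserted): for
every smooth even real `g` with `supp g ⊆ [−1−ε, 1+ε]`, eventually along the primes `q`,
`‖D⁺(g; q) − (g(0) + ½∫_{−1}^{1} g)‖ ≤ ∫_{u>1} |g| + K·ε·e^{−κ/ε}·sup|g| + 1/log q`
(the SO(even) value is the tree's `soEvenLimit`, E-I3-1-corrected). The card states honestly that
`limsup |R|` is `≤ Kεe^{−κ′/ε}‖g‖_∞`, NOT `o(1)` (falsifier F4). A PREDICATE in `(k, ε, K, κ)`;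
typed ≠ proved. [cite: IwaniecLuoSarnak2000, Thm. 1.1 and §6 (159)–(161) (where GRH enters for the non-exceptional zeros)] -/
def SignedDensityTailBound (k : ℤ) (ε K κ : ℝ) : Prop :=
  ∀ g : ℝ → ℝ, ContDiff ℝ (⊤ : ℕ∞) g → (∀ u, g (-u) = g u) →
    tsupport g ⊆ Set.Icc (-(1 + ε)) (1 + ε) →
      ∀ᶠ q : {q : ℕ // q.Prime} in Filter.atTop,
        haveI : NeZero (q : ℕ) := ⟨q.2.ne_zero⟩
        ‖OneLevelDensityCusp.evenDensity (q : ℕ) k (fun u ↦ (g u : ℂ)) -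
            OneLevelDensityCusp.soEvenLimit (fun u ↦ (g u : ℂ))‖ ≤
          (∫ u in Set.Ioi (1 : ℝ), |g u|) + K * ε * Real.exp (-κ / ε) * (⨆ u : ℝ, |g u|) +
            1 / Real.log (q : ℕ)

/-- Bookkeeping (proved, definitional): the door is monotone in the contraction — a door with
`θ₁` is a door with every `θ₂ ≥ θ₁`. [cite: IwaniecLuoSarnak2000, Thm. 1.1] -/
theorem SignedWindowMassDoor.mono_theta {k : ℤ} {d₀ d₁ θ₁ θ₂ : ℝ} (h : θ₁ ≤ θ₂)
    (hD : SignedWindowMassDoor k d₀ d₁ θ₁) : SignedWindowMassDoor k d₀ d₁ θ₂ :=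
  fun g hg θ' hθ' ↦ hD g hg θ' (lt_of_le_of_lt h hθ')

/-- Bookkeeping (proved, definitional): a profile on a window is a profile on every larger window.
[cite: IwaniecLuoSarnak2000, Thm. 1.1] -/
theorem IsWindowProfile.of_subwindow {d₀ d₁ d₀' d₁' : ℝ} (h₀ : d₀' ≤ d₀) (h₁ : d₁ ≤ d₁')
    {g : ℝ → ℝ} (hg : IsWindowProfile d₀ d₁ g) : IsWindowProfile d₀' d₁' g := by
  obtain ⟨h1, h2, h3, h4⟩ := hg
  refine ⟨h1, h2, h3, h4.trans ?_⟩
  intro u hu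
  obtain ⟨ha, hb⟩ := hu
  exact ⟨by linarith, by linarith⟩

/-- Bookkeeping (proved, definitional): a door on a window is a door on every sub-window (fewer
profiles to control). [cite: IwaniecLuoSarnak2000, Thm. 1.1] -/
theorem SignedWindowMassDoor.subwindow {k : ℤ} {d₀ d₁ d₀' d₁' θ : ℝ} (h₀ : d₀ ≤ d₀')
    (h₁ : d₁' ≤ d₁) (hD : SignedWindowMassDoor k d₀ d₁ θ) : SignedWindowMassDoor k d₀' d₁' θ :=
  fun g hg θ' hθ' ↦ hD g (hg.of_subwindow h₀ h₁) θ' hθ'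

/-- Bookkeeping (proved, definitional): modus ponens for the bridge — if the bridge holds at `(k, A)`
and a door with `θ < 1` on a non-degenerate window at weight `k` is given, `LOneLowerBound A` follows
(recorded for the consumers; the card's instance is `k = 2`, `A = 1`).
[cite: Zhang2022LandauSiegel, §1 Theorem 1] -/
theorem lOneLowerBound_of_windowMassDoor {k : ℤ} {A : ℕ} (hB : WindowMassDoorBridge k A)
    {d₀ d₁ θ : ℝ} (h₀ : 0 < d₀) (h₁ : d₀ < d₁) (hθ : θ < 1) (hD : SignedWindowMassDoor k d₀ d₁ θ) :
    Zhang2022.Skeleton.LOneLowerBound A :=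
  hB ⟨d₀, d₁, θ, h₀, h₁, hθ, hD⟩

/-- Bookkeeping (proved, definitional): the bridge is antitone in the weight-free data — a bridge at
exponent `A` is a bridge at every `B ≥ A` (via the tree's `lOneLowerBound_mono`).
[cite: Zhang2022LandauSiegel, §1 Theorem 1] -/
theorem WindowMassDoorBridge.mono {k : ℤ} {A B : ℕ} (hAB : A ≤ B) (h : WindowMassDoorBridge k A) :
    WindowMassDoorBridge k B := by
  intro hD
  obtain ⟨c₁, hc₁, hc⟩ := h hD
  refine ⟨c₁, hc₁, fun D _ χ hD3 hq hp ↦ lt_of_le_of_lt ?_ (hc D χ hD3 hq hp)⟩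
  have h3 : (3 : ℝ) ≤ D := by exact_mod_cast hD3
  have hlog : 1 ≤ Real.log (D : ℝ) := by
    rw [← Real.log_exp 1]
    exact Real.log_le_log (Real.exp_pos 1) (by linarith [Real.exp_one_lt_d9])
  exact div_le_div_of_nonneg_left hc₁.le (by positivity) (pow_le_pow_right₀ hlog hAB)

/-- Sanity (proved, definitional): the (E-I3-1-corrected, p590857) SO(even) functional vanishes when
`g 0 = 0` and the `[−1,1]`-integral vanishes — the trivial direction used by the card for window
profiles (the SO(even) prediction of a window profile is `0`). [cite: IwaniecLuoSarnak2000, §1 (1.4)] -/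
theorem soEvenLimit_eq_zero {g : ℝ → ℂ} (h0 : g 0 = 0)
    (h1 : ∫ u in Set.Icc (-1 : ℝ) 1, g u = 0) : OneLevelDensityCusp.soEvenLimit g = 0 := by
  simp [OneLevelDensityCusp.soEvenLimit, h0, h1]

/-! ## §4 K-I3-9 «THE LINNIK-ZERO LEDGER OF THE SIGNED PRIME-LEVEL DENSITY», item (5) DIRECT DOOR
(lens-3 gen 4; critics A b44 · B b49 · C b47 PASS, ledger + structure law + direct door, not ★) — the
desk's ★-DOORS LINE-READINESS PACKET v1 §6 item 3: «`soEvenLawBeyondOne_lOneLowerBound :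
(∃ v > 1, EvenDensitySOEven 2 v) → LOneLowerBound A` as a criterion Prop (NOT a fact)». Typed
PARAMETRIC in `(k, A)` (card instance `k = 2`, any `A ≥ 3`) so that the gate does not read a 0-ary
`Prop` as a citable fact. Card content (pencil, NOT asserted): if `L(1,χ_{D_j})(log D_j)^A → 0` then for
every prime `N ∈ [D_j^{c₁}, 2D_j^{c₁}]`, `c₁ > 2/(v−1)`, the (A)-world law (4) gives
`|D⁺(g;N) − ∫gŴ(SO(even))| ≥ ∫_{1+2/c₁}^{v} g − o(1) > 0` for a bump `g ≥ 0` there, contradicting the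
SO(even) law along all primes — «no compatibility, no ownership, no atom inequality, no v*». -/

/-- **K-I3-9 (5) — the DIRECT DENSITY DOOR as a criterion**: the SO(even) one-level-density law for
`H_k^+(q)` along the primes with SOME Fourier support `v > 1` implies `L(1,χ_D) ≫ (log D)^{−A}`
(`Zhang2022.Skeleton.LOneLowerBound A`). Reading for the GAP-TABLE (card): F8's hypothesis
`EvenDensitySOEven 2 v` is summit-complete already at support `1 + ε`; G-25's price cell is the
Linnik-zero statistic, not a zero-free box. A PARAMETRIC `Prop` (an implication) in `(k, A)`; NOT
asserted, NOT a published fact (falsifier F5: no printed statement «SO(even) law beyond support 1 ⇒ no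
Landau–Siegel zero» was found); typed ≠ proved. [cite: IwaniecLuoSarnak2000, remark (B) p. 4 and p. 5 («intimately connected to the Landau–Siegel zero»)] [cite: Zhang2022LandauSiegel, §1 Theorem 1 (the shape LOneLowerBound)] -/
def SOEvenBeyondOneDoor (k : ℤ) (A : ℕ) : Prop :=
  (∃ v : ℝ, 1 < v ∧ OneLevelDensityCusp.EvenDensitySOEven k v) →
    Zhang2022.Skeleton.LOneLowerBound A

/-- Bookkeeping (proved, definitional): modus ponens for the direct door.
[cite: Zhang2022LandauSiegel, §1 Theorem 1] -/
theorem lOneLowerBound_of_soEvenBeyondOneDoor {k : ℤ} {A : ℕ} (hdoor : SOEvenBeyondOneDoor k A)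
    {v : ℝ} (hv : 1 < v) (hlaw : OneLevelDensityCusp.EvenDensitySOEven k v) :
    Zhang2022.Skeleton.LOneLowerBound A :=
  hdoor ⟨v, hv, hlaw⟩

/-- Bookkeeping (proved, definitional): the direct door is monotone in the exponent `A`.
[cite: Zhang2022LandauSiegel, §1 Theorem 1] -/
theorem SOEvenBeyondOneDoor.mono {k : ℤ} {A B : ℕ} (hAB : A ≤ B) (h : SOEvenBeyondOneDoor k A) :
    SOEvenBeyondOneDoor k B := by
  intro hlaw
  obtain ⟨c₁, hc₁, hc⟩ := h hlaw
  refine ⟨c₁, hc₁, fun D _ χ hD3 hq hp ↦ lt_of_le_of_lt ?_ (hc D χ hD3 hq hp)⟩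
  have h3 : (3 : ℝ) ≤ D := by exact_mod_cast hD3
  have hlog : 1 ≤ Real.log (D : ℝ) := by
    rw [← Real.log_exp 1]
    exact Real.log_le_log (Real.exp_pos 1) (by linarith [Real.exp_one_lt_d9])
  exact div_le_div_of_nonneg_left hc₁.le (by positivity) (pow_le_pow_right₀ hlog hAB)

/-- Bookkeeping (proved, definitional): K-L7-2's `DensityDoor v A δ K p₁ a` at ONE support `v > 1`,
fed by the SO(even) law at that support and the printed §7 shapes, gives the leaf lower bound with
exponent `max A (2a)` in the `(log D)`-power/`re`-form of lens-4's consumer (`lOne_lowerBound_of_densityDoor`);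
the direct door `SOEvenBeyondOneDoor` asks for the `Zhang2022.Skeleton.LOneLowerBound` form from the
bare law. The two forms are recorded side by side; no implication between them is claimed here.
[cite: IwaniecLuoSarnak2000, Thm. 1.1] -/
theorem soEvenBeyondOneDoor_iff (k : ℤ) (A : ℕ) :
    SOEvenBeyondOneDoor k A ↔
      ∀ v : ℝ, 1 < v → OneLevelDensityCusp.EvenDensitySOEven k v →
        Zhang2022.Skeleton.LOneLowerBound A :=
  ⟨fun h v hv hlaw ↦ h ⟨v, hv, hlaw⟩, fun h ⟨v, hv, hlaw⟩ ↦ h v hv hlaw⟩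

end Summit.Parity.GeneralizedHardyLittlewood.Theorems.PrimeLevelFamEdgeIdeaDeltas
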